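import Summits.BirchSwinnertonDyer.BirchSwinnertonDyer.Theses.GenusKolyvaginAtTwo
import Summits.BirchSwinnertonDyer.BirchSwinnertonDyer.Theorems.GenusKolyvaginAtTwoLeafCensusShaCellSplit
import HarnessLib

/-!
# LINE DRAFT «sha_cell_twin_swap» v0.1 (FOUR stubs: WALL(GK2)×4 · DIV⁰|Ш · NDIV⁰|Ш · PRINT×6) on the NEW crux `RankOneShaCellBSDTwo`
# (stmt-BirchSwinnertonDyer-27477, route `GenusKolyvaginAtTwo` rev 71) — LINE 23 «twin_swap» v2.5 TRANSPORTED to the Ш-cell (LEAD bsd-line-gk2-p1 g32)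

OFFER / DRAFT for the planner-of-record (bsd-idea-1) and the critic: NOT registered, NOT a proposal.  Nothing here proves BSD, the Ш-cell, the wall,
DIV⁰|Ш or NDIV⁰|Ш.  It is LINE 23's composition verbatim with U₂'s Selmer clause `#Sel₂(W) = 2` replaced by the Ш-cell's «`W(ℚ)[2] = 0 ∧ #Sel₂(W) ≠ 2`»
— the engine is p801119 `…Census.ShaCell.shaCell_of_wall_of_friedbergHoffstein_of_kex0Sha_of_facts` (p796542's Selmer-free engine restricted to the cell),
fed with KEX⁰|Ш := DIV⁰|Ш ∧ NDIV⁰|Ш at the exact `2`-depth of `P(1)` (which EXISTS: `P(1)` has infinite order by Gross–Zagier, `W(K[1])` is finitely generated).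

* DIV⁰|Ш `HeegnerIndexUpperShaCellAtTwo`: on every odd Heegner frame with `2` split of a curve of the cell, at every exact depth `M₀` of `P(1)`:
  `#Ш(W_K)[2^∞] · 4^{ord₂ c + ord₂ C(W)} ∣ 4^{M₀}` — the product-form Kolyvagin–Jetchev UPPER bound at `2` (research; beyond print at `2`);
* NDIV⁰|Ш `HeegnerIndexLowerShaCellAtTwo`: `4^{M₀} ∣ #Ш(W_K)[2^∞] · 4^{ord₂ c + ord₂ C(W)}` — Kolyvagin NON-VANISHING / exactness at `2` (research); on the
  Ш-cell `M₀ ≥ 1` is expected generically (`Ш(W)[2] ≠ 0`), so unlike U₂'s (★)-frames the lower half is NOT automatic here — this is the cell's price.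
KEX⁰|Ш ⟺ DIV⁰|Ш ∧ NDIV⁰|Ш (`heegnerIndexRelationSha_of_halves`, `halves_of_heegnerIndexRelationSha`); both halves LOSSLESS
(`halves_of_shaCell_of_wall_of_facts`, from p801119 `kex0Sha_of_shaCell_of_wall_of_facts`).  **hSha ⟸ WALL(GK2)×4 + DIV⁰|Ш + NDIV⁰|Ш + PRINT×6.**
BSD is NOT proved by any of this.
-/

set_option linter.dupNamespace false -- `Summit.<P>.<Sub>` repeats `BirchSwinnertonDyer` (D-0017)

namespace Summit.BirchSwinnertonDyer.BirchSwinnertonDyer.Cruxes.RankOneShaCellBSDTwo.TwinSwapSha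

open scoped Classical NumberField

open Summit.BirchSwinnertonDyer.BirchSwinnertonDyer.Theses.GenusKolyvaginAtTwo
open WeierstrassCurve NumberField Literature.NumberTheory.EllipticCurves Literature.NumberTheory.EllipticCurves.ModularForms
open Summit.BirchSwinnertonDyer.BirchSwinnertonDyer.Theorems
open Summit.BirchSwinnertonDyer.BirchSwinnertonDyer.Theorems.GenusExact.Census.ShaCell
  (shaCell_of_wall_of_friedbergHoffstein_of_kex0Sha_of_facts kex0Sha_of_shaCell_of_wall_of_facts)
open Summit.BirchSwinnertonDyer.BirchSwinnertonDyer.Theorems.GenusExact.Census.TorsionCell (bsdp_rankZero_of_wallGK2)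
open Summit.BirchSwinnertonDyer.BirchSwinnertonDyer.Theorems.GenusExact.TwinSwap.Ledger.Line25
  (not_isOfFinAddOrder_derivedPoint_one_of_rankOne_of_lValue_ne_zero)
open Summit.BirchSwinnertonDyer.BirchSwinnertonDyer.Theorems.KolyvaginAtTwo (exists_exactTwoDepth)

/-! ## The displayed Props (KEX⁰|Ш and its two halves DIV⁰|Ш, NDIV⁰|Ш) -/

/-- KEX⁰|Ш · the `2`-primary Gross–Zagier index relation for a curve OF THE Ш-CELL (non-CM, `r_an = 1`, `W(ℚ)[2] = 0`, `#Sel₂(W) ≠ 2`) at every odd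
Heegner frame with `2` split, any globally minimal twin: SOME exact depth `2^{M₀} ∥ P(1)` has `#Ш(W_K)[2^∞] · 4^{ord₂ c + ord₂ C(W)} = 4^{M₀}`.
= binder `hKEX0Sha` of p801119 VERBATIM.  Derived below from DIV⁰|Ш ∧ NDIV⁰|Ш. -/
def HeegnerIndexRelationShaCellAtTwo : Prop :=
  ∀ (W : WeierstrassCurve ℚ) [W.IsElliptic] [W.IsGloballyMinimal] [NeZero (W.conductorNorm ℤ)],
    ¬ W.HasCM → W.analyticRank = 1 → (∀ P : W.toAffine.Point, 2 • P = 0 → P = 0) → Nat.card (W.selmerGroup 2) ≠ 2 →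
    ∀ (K : Type) [Field K] [NumberField K], IsImaginaryQuadratic K →
      Odd (NumberField.discr K) → NumberField.discr K ≠ -3 → SatisfiesHeegnerHypothesis (W.conductorNorm ℤ) K →
      ((Ideal.span {(2 : ℤ)}).primesOver (𝓞 K)).ncard = 2 →
      ∀ (Wd : WeierstrassCurve ℚ) [Wd.IsElliptic] [Wd.IsGloballyMinimal],
        (∃ C : VariableChange ℚ, C • W.quadraticTwist (NumberField.discr K : ℚ) = Wd) →
      (W.quadraticTwist (NumberField.discr K : ℚ)).entireLFunction 1 ≠ 0 →
      ∀ (Dt : ModularParametrizationData W (W.conductorNorm ℤ)) (β : ℤ) (ι : K →+* ℂ) (d₁ : KolyvaginHeegnerData Dt β ι 1),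
        ∃ M₀ : ℕ,
          (∃ Q : (W.baseChange (ringClassField K ι 1)).toAffine.Point, ((2 ^ M₀ : ℕ) : ℤ) • Q = d₁.derivedPoint) ∧
          (¬ ∃ Q : (W.baseChange (ringClassField K ι 1)).toAffine.Point, ((2 ^ (M₀ + 1) : ℕ) : ℤ) • Q = d₁.derivedPoint) ∧
          Nat.card (AddCommGroup.primaryComponent (W.baseChange K).sha 2) *
              2 ^ (2 * (padicValInt 2 Dt.c + padicValNat 2 W.tamagawaProduct)) = 2 ^ (2 * M₀)

/-- DIV⁰|Ш · THE UPPER HALF on the Ш-cell: for EVERY exact depth `M₀` of `P(1)`, `#Ш(W_K)[2^∞] · 4^{ord₂ c + ord₂ C(W)} ∣ 4^{M₀}` (product-form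
Kolyvagin–Jetchev bound at `2` for the rank-one member; research, beyond print at `2`). -/
def HeegnerIndexUpperShaCellAtTwo : Prop :=
  ∀ (W : WeierstrassCurve ℚ) [W.IsElliptic] [W.IsGloballyMinimal] [NeZero (W.conductorNorm ℤ)],
    ¬ W.HasCM → W.analyticRank = 1 → (∀ P : W.toAffine.Point, 2 • P = 0 → P = 0) → Nat.card (W.selmerGroup 2) ≠ 2 →
    ∀ (K : Type) [Field K] [NumberField K], IsImaginaryQuadratic K →
      Odd (NumberField.discr K) → NumberField.discr K ≠ -3 → SatisfiesHeegnerHypothesis (W.conductorNorm ℤ) K →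
      ((Ideal.span {(2 : ℤ)}).primesOver (𝓞 K)).ncard = 2 →
      ∀ (Wd : WeierstrassCurve ℚ) [Wd.IsElliptic] [Wd.IsGloballyMinimal],
        (∃ C : VariableChange ℚ, C • W.quadraticTwist (NumberField.discr K : ℚ) = Wd) →
      (W.quadraticTwist (NumberField.discr K : ℚ)).entireLFunction 1 ≠ 0 →
      ∀ (Dt : ModularParametrizationData W (W.conductorNorm ℤ)) (β : ℤ) (ι : K →+* ℂ) (d₁ : KolyvaginHeegnerData Dt β ι 1) (M₀ : ℕ),
        (∃ Q : (W.baseChange (ringClassField K ι 1)).toAffine.Point, ((2 ^ M₀ : ℕ) : ℤ) • Q = d₁.derivedPoint) →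
        (¬ ∃ Q : (W.baseChange (ringClassField K ι 1)).toAffine.Point, ((2 ^ (M₀ + 1) : ℕ) : ℤ) • Q = d₁.derivedPoint) →
          Nat.card (AddCommGroup.primaryComponent (W.baseChange K).sha 2) *
              2 ^ (2 * (padicValInt 2 Dt.c + padicValNat 2 W.tamagawaProduct)) ∣ 2 ^ (2 * M₀)

/-- NDIV⁰|Ш · THE LOWER HALF on the Ш-cell: for EVERY exact depth `M₀` of `P(1)`, `4^{M₀} ∣ #Ш(W_K)[2^∞] · 4^{ord₂ c + ord₂ C(W)}` (Kolyvagin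
NON-VANISHING / exactness at `2` for the rank-one member; research).  NOT automatic on this cell: `Ш(W)[2] ≠ 0` makes `M₀ ≥ 1` the generic case. -/
def HeegnerIndexLowerShaCellAtTwo : Prop :=
  ∀ (W : WeierstrassCurve ℚ) [W.IsElliptic] [W.IsGloballyMinimal] [NeZero (W.conductorNorm ℤ)],
    ¬ W.HasCM → W.analyticRank = 1 → (∀ P : W.toAffine.Point, 2 • P = 0 → P = 0) → Nat.card (W.selmerGroup 2) ≠ 2 →
    ∀ (K : Type) [Field K] [NumberField K], IsImaginaryQuadratic K →
      Odd (NumberField.discr K) → NumberField.discr K ≠ -3 → SatisfiesHeegnerHypothesis (W.conductorNorm ℤ) K →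
      ((Ideal.span {(2 : ℤ)}).primesOver (𝓞 K)).ncard = 2 →
      ∀ (Wd : WeierstrassCurve ℚ) [Wd.IsElliptic] [Wd.IsGloballyMinimal],
        (∃ C : VariableChange ℚ, C • W.quadraticTwist (NumberField.discr K : ℚ) = Wd) →
      (W.quadraticTwist (NumberField.discr K : ℚ)).entireLFunction 1 ≠ 0 →
      ∀ (Dt : ModularParametrizationData W (W.conductorNorm ℤ)) (β : ℤ) (ι : K →+* ℂ) (d₁ : KolyvaginHeegnerData Dt β ι 1) (M₀ : ℕ),
        (∃ Q : (W.baseChange (ringClassField K ι 1)).toAffine.Point, ((2 ^ M₀ : ℕ) : ℤ) • Q = d₁.derivedPoint) →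
        (¬ ∃ Q : (W.baseChange (ringClassField K ι 1)).toAffine.Point, ((2 ^ (M₀ + 1) : ℕ) : ℤ) • Q = d₁.derivedPoint) →
          2 ^ (2 * M₀) ∣ Nat.card (AddCommGroup.primaryComponent (W.baseChange K).sha 2) *
              2 ^ (2 * (padicValInt 2 Dt.c + padicValNat 2 W.tamagawaProduct))

/-! ## The four stubs (WALL(GK2)×4 bundled · DIV⁰|Ш · NDIV⁰|Ш · PRINT×6 bundled) -/

/-- stub WALL = the route's four WALL binders `Wall{GoodOrdinary,Multiplicative,Supersingular,Additive}RankZeroAtTwo` (items 19095–19098) BY NAME. -/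
theorem stub_wallRankZeroAtTwo :
    WallGoodOrdinaryRankZeroAtTwo ∧ WallMultiplicativeRankZeroAtTwo ∧ WallSupersingularRankZeroAtTwo ∧ WallAdditiveRankZeroAtTwo := by
  sorry

/-- stub DIV⁰|Ш — the upper half on the Ш-cell (research). -/
theorem stub_heegnerIndexUpperSha : HeegnerIndexUpperShaCellAtTwo := by
  sorry

/-- stub NDIV⁰|Ш — the lower half on the Ш-cell (research; the cell's price). -/
theorem stub_heegnerIndexLowerSha : HeegnerIndexLowerShaCellAtTwo := by
  sorry

/-- stub PRINT = the route's four print items BY NAME (`GrossZagierAllLevels` 24148, `MultPublishedInputsAtTwo` 19921, `EntireLFunctionRat` 19273,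
`MilneAnyModel` 24149) + BCDT `nonempty_modularParametrizationData` + Friedberg–Hoffstein `friedbergHoffstein_exists_heegnerField_split_twist_ne_zero`
(Literature statement-only facts, in print) — the same bundle as LINE 23 v2.5. -/
theorem stub_printFacts :
    GrossZagierAllLevels ∧ MultPublishedInputsAtTwo ∧ EntireLFunctionRat ∧ MilneAnyModel ∧ nonempty_modularParametrizationData ∧
      friedbergHoffstein_exists_heegnerField_split_twist_ne_zero := by
  sorry

/-! ## Closed pieces: uniqueness of the exact depth, KEX⁰|Ш ⟺ DIV⁰|Ш ∧ NDIV⁰|Ш, losslessness -/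

/-- The exact `2`-depth of an element of an additive group is unique. [folklore] -/
theorem exactTwoDepth_unique {A : Type*} [AddCommGroup A] {y : A} {a b : ℕ}
    (ha : ∃ Q : A, ((2 ^ a : ℕ) : ℤ) • Q = y) (ha' : ¬ ∃ Q : A, ((2 ^ (a + 1) : ℕ) : ℤ) • Q = y)
    (hb : ∃ Q : A, ((2 ^ b : ℕ) : ℤ) • Q = y) (hb' : ¬ ∃ Q : A, ((2 ^ (b + 1) : ℕ) : ℤ) • Q = y) : a = b := by
  by_contra hne
  rcases Nat.lt_or_gt_of_ne hne with h | h
  · obtain ⟨Q, hQ⟩ := hb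
    exact ha' ⟨((2 ^ (b - (a + 1)) : ℕ) : ℤ) • Q, by
      rw [smul_smul, ← hQ]; congr 1; rw [← Nat.cast_mul, ← pow_add]; congr 2; omega⟩
  · obtain ⟨Q, hQ⟩ := ha
    exact hb' ⟨((2 ^ (a - (b + 1)) : ℕ) : ℤ) • Q, by
      rw [smul_smul, ← hQ]; congr 1; rw [← Nat.cast_mul, ← pow_add]; congr 2; omega⟩

/-- **KEX⁰|Ш ⟸ DIV⁰|Ш ∧ NDIV⁰|Ш** (modulo Gross–Zagier + modularity, used only to know that `P(1)` has infinite order, so its exact `2`-depth EXISTS in the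
finitely generated `W(K[1])`); at that depth `Nat.dvd_antisymm`.  [cite: GrossZagier1986, V.§2 (2.2)] [cite: McCallumLMS1991, §5 Lemma 5.1] -/
theorem heegnerIndexRelationSha_of_halves
    (hGZ : ∀ (N : ℕ) [NeZero N] (W : WeierstrassCurve ℚ) (K : Type) [Field K] [NumberField K], gross_zagier N W K)
    (hmod : hasEntireLFunction_rat)
    (hU : HeegnerIndexUpperShaCellAtTwo) (hL : HeegnerIndexLowerShaCellAtTwo) : HeegnerIndexRelationShaCellAtTwo := by
  intro W _ _ _ hcm hr hT2 hSel K _ _ hK hodd h3 hH h2K Wd _ _ hWd hLv Dt β ι d₁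
  have hy : ¬ IsOfFinAddOrder d₁.derivedPoint :=
    not_isOfFinAddOrder_derivedPoint_one_of_rankOne_of_lValue_ne_zero hmod W K (hGZ _ W K) hK hH hr hLv d₁
  haveI := (finiteDimensional_and_isGalois_ringClassField hK ι one_ne_zero).1
  haveI : NumberField (ringClassField K ι 1) := NumberField.of_module_finite K _
  haveI : (W.baseChange (ringClassField K ι 1)).IsElliptic := by rw [baseChange]; infer_instance
  haveI : Module.Finite ℤ (W.baseChange (ringClassField K ι 1)).toAffine.Point := by
    convert (W.baseChange (ringClassField K ι 1)).module_finite_point_holds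
  obtain ⟨M₀, hdiv, hndiv⟩ := exists_exactTwoDepth
    (A := (W.baseChange (ringClassField K ι 1)).toAffine.Point) (y := d₁.derivedPoint) (by convert hy)
  exact ⟨M₀, hdiv, hndiv, Nat.dvd_antisymm (hU W hcm hr hT2 hSel K hK hodd h3 hH h2K Wd hWd hLv Dt β ι d₁ M₀ hdiv hndiv)
    (hL W hcm hr hT2 hSel K hK hodd h3 hH h2K Wd hWd hLv Dt β ι d₁ M₀ hdiv hndiv)⟩

/-- **DIV⁰|Ш ∧ NDIV⁰|Ш ⟸ KEX⁰|Ш** (unconditional: the exact depth is unique). [folklore] -/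
theorem halves_of_heegnerIndexRelationSha (hKEX : HeegnerIndexRelationShaCellAtTwo) :
    HeegnerIndexUpperShaCellAtTwo ∧ HeegnerIndexLowerShaCellAtTwo := by
  refine ⟨?_, ?_⟩
  · intro W _ _ _ hcm hr hT2 hSel K _ _ hK hodd h3 hH h2K Wd _ _ hWd hLv Dt β ι d₁ M₀ hdiv hndiv
    obtain ⟨M₁, hdiv₁, hndiv₁, heq⟩ := hKEX W hcm hr hT2 hSel K hK hodd h3 hH h2K Wd hWd hLv Dt β ι d₁
    rw [exactTwoDepth_unique hdiv hndiv hdiv₁ hndiv₁, ← heq]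
  · intro W _ _ _ hcm hr hT2 hSel K _ _ hK hodd h3 hH h2K Wd _ _ hWd hLv Dt β ι d₁ M₀ hdiv hndiv
    obtain ⟨M₁, hdiv₁, hndiv₁, heq⟩ := hKEX W hcm hr hT2 hSel K hK hodd h3 hH h2K Wd hWd hLv Dt β ι d₁
    rw [exactTwoDepth_unique hdiv hndiv hdiv₁ hndiv₁, ← heq]

/-- ★ **BOTH HALVES ARE LOSSLESS: Ш-cell + WALL(GK2)×4 + PRINT ⟹ DIV⁰|Ш ∧ NDIV⁰|Ш** (p801119 `kex0Sha_of_shaCell_of_wall_of_facts` + uniqueness of the exact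
depth).  So modulo the wall and PRINT, `RankOneShaCellBSDTwo ⟺ DIV⁰|Ш ∧ NDIV⁰|Ш`.  CONDITIONAL; closes nothing.
[cite: GrossZagier1986, V.§2 (2.2)] [cite: Milne1972ArithmeticAV, §1 Thm. 1] -/
theorem halves_of_shaCell_of_wall_of_facts
    (hGZ : ∀ (N : ℕ) [NeZero N] (W : WeierstrassCurve ℚ) (K : Type) [Field K] [NumberField K], gross_zagier N W K)
    (hGZK : rank_eq_analyticRank_of_analyticRank_le_one) (hmod : hasEntireLFunction_rat)
    (hMilneC : Milne1972.bsdQuotient_baseChange_quadratic_anyModel)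
    (hOrd : WallGoodOrdinaryRankZeroAtTwo) (hMult : WallMultiplicativeRankZeroAtTwo)
    (hSS : WallSupersingularRankZeroAtTwo) (hAdd : WallAdditiveRankZeroAtTwo)
    (hSha : Summit.BirchSwinnertonDyer.BirchSwinnertonDyer.Theses.GenusKolyvaginAtTwo.RankOneShaCellBSDTwo) :
    HeegnerIndexUpperShaCellAtTwo ∧ HeegnerIndexLowerShaCellAtTwo :=
  halves_of_heegnerIndexRelationSha
    (kex0Sha_of_shaCell_of_wall_of_facts hGZ hGZK hmod hMilneC (fun W _ _ hcm hr0 ↦ bsdp_rankZero_of_wallGK2 hOrd hMult hSS hAdd W hcm hr0) hSha)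

/-! ## The composition -/

/-- COMPOSITION with displayed inputs (kernel-checked, no sorry of its own): WALL(GK2)×4 + DIV⁰|Ш + NDIV⁰|Ш + PRINT×6 prove the Ш-cell — ONE cell, no
converse, no residual (p801119's engine fed with KEX⁰|Ш := `heegnerIndexRelationSha_of_halves`). -/
theorem rankOneShaCellBSDTwo_of_inputs (hOrd : WallGoodOrdinaryRankZeroAtTwo) (hMult : WallMultiplicativeRankZeroAtTwo)
    (hSS : WallSupersingularRankZeroAtTwo) (hAdd : WallAdditiveRankZeroAtTwo)
    (hU : HeegnerIndexUpperShaCellAtTwo) (hL : HeegnerIndexLowerShaCellAtTwo)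
    (hGZ : GrossZagierAllLevels) (hGZK : MultPublishedInputsAtTwo) (hLf : EntireLFunctionRat) (hMi : MilneAnyModel)
    (hMP : nonempty_modularParametrizationData) (hFH : friedbergHoffstein_exists_heegnerField_split_twist_ne_zero) :
    ∀ (W : WeierstrassCurve ℚ) [W.IsElliptic] [W.IsGloballyMinimal], ¬ W.HasCM → W.analyticRank = 1 →
      (∀ P : W.toAffine.Point, 2 • P = 0 → P = 0) → Nat.card (W.selmerGroup 2) ≠ 2 → Literature.NumberTheory.EllipticCurves.BSDp W 2 :=
  shaCell_of_wall_of_friedbergHoffstein_of_kex0Sha_of_facts hGZ hGZK hLf hMi hMP hFH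
    (fun W _ _ hcm hr0 ↦ bsdp_rankZero_of_wallGK2 hOrd hMult hSS hAdd W hcm hr0) (heegnerIndexRelationSha_of_halves hGZ hLf hU hL)

/-- **THE LINE CONCLUDES THE CRUX BY NAME**: `RankOneShaCellBSDTwo` (stmt-BirchSwinnertonDyer-27477) from the four stubs — WALL(GK2)×4 (items, bundled),
DIV⁰|Ш, NDIV⁰|Ш, PRINT×6 (bundled).  Sorry-free outside the stubs; no converse, no residual locus. -/
theorem RankOneShaCellBSDTwo_of : Summit.BirchSwinnertonDyer.BirchSwinnertonDyer.Theses.GenusKolyvaginAtTwo.RankOneShaCellBSDTwo :=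
  rankOneShaCellBSDTwo_of_inputs stub_wallRankZeroAtTwo.1 stub_wallRankZeroAtTwo.2.1 stub_wallRankZeroAtTwo.2.2.1 stub_wallRankZeroAtTwo.2.2.2
    stub_heegnerIndexUpperSha stub_heegnerIndexLowerSha
    stub_printFacts.1 stub_printFacts.2.1 stub_printFacts.2.2.1 stub_printFacts.2.2.2.1 stub_printFacts.2.2.2.2.1 stub_printFacts.2.2.2.2.2

end Summit.BirchSwinnertonDyer.BirchSwinnertonDyer.Cruxes.RankOneShaCellBSDTwo.TwinSwapSha
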